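import Mathlib
import Summits.ValiantsHypothesis.ValiantsHypothesis.Theorems.BarrierLeverSuccinctHittingSetsForVPDimensionCount
import HarnessLib

/-!
# Item `BarrierLever.NaturalProofsSeparateVNP` (stmt-ValiantsHypothesis-18972), SIGN SLICE —
# part 1: few sign vectors lie on the image of a low-degree polynomial map (zero-pattern count)

Support file for the unconditional SIGN-SLICE form of the item (Chatterjee–Kumar–Ramya–Saptharishi–
Tengse 2020, Thm. 1.1, in the tree frame: natural proofs against `SmallCircuits ℂ n b ∩ signCoeffSlice`
exist for every `b`). This file is pure linear algebra, no circuits: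

* `ZeroPatterns.card_le_of_signVectors_mem_image` — if `G : ι → ℂ[y₁,…,y_p]` has coordinates of
  total degree `≤ δ`, then any finite set `S` of SIGN vectors (`c i ∈ {0, 1, -1}`) lying on the image
  of `y ↦ (G i (y))_i` has `#S ≤ (2 · #ι · δ + 1) ^ p`.

Proof (Rónyai–Babai–Ganapathy's linear-algebra count, diagonal case): for `c ∈ S` pick `y_c` with
`G(y_c) = c` and put `P_c := ∏_i ∏_{ε ∈ {0,1,-1} ∖ {c i}} (G i - ε)`, of total degree `≤ #ι · 2δ`;
then `P_c(y_{c'}) ≠ 0 ↔ c' = c`, so the `P_c` are linearly independent inside the polynomials of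
total degree `≤ #ι · 2δ` in `p` variables, a space of dimension `≤ (#ι · 2δ + 1) ^ p`
(`LowDegreeEquations.degLE_injective`, tree).

References: [RonyaiBabaiGanapathy2001] L. Rónyai, L. Babai, M. K. Ganapathy, *On the number of
zero-patterns of a sequence of polynomials*, J. AMS 14 (2001), Thm. 1.1 (the general count; only the
diagonal special case is proved here); [ChatterjeeKumarRamyaSaptharishiTengse2020] §4 (where a
count of this kind is replaced by Heintz–Schnorr hitting sets).
-/

-- layout Summits/ValiantsHypothesis/ValiantsHypothesis forces the duplicated namespace component
set_option linter.dupNamespace false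

namespace Summit.ValiantsHypothesis.ValiantsHypothesis.Theorems.BarrierLever.NaturalProofsSeparateVNP

open MvPolynomial
open Summit.ValiantsHypothesis.ValiantsHypothesis.Theorems.BarrierLever.SuccinctHittingSetsForVP

namespace ZeroPatterns

variable {ι : Type*} [Fintype ι] {p : ℕ}

/-- The three admissible coordinate values `{0, 1, -1}` of a sign vector. [folklore] -/
noncomputable def signs : Finset ℂ := {0, 1, -1}

/-- `c` is a sign vector iff every coordinate lies in `signs`. [folklore] -/
theorem mem_signs_iff (z : ℂ) : z ∈ signs ↔ (z = 0 ∨ z = 1 ∨ z = -1) := by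
  simp [signs]

/-- `signs` has exactly three elements. [folklore] -/
theorem card_signs : signs.card = 3 := by
  have h1 : (1 : ℂ) ≠ -1 := by norm_num
  have h0 : (0 : ℂ) ≠ 1 := by norm_num
  have h0' : (0 : ℂ) ≠ -1 := by norm_num
  simp [signs, h1, h0, h0']

/-- Removing one member of `signs` leaves two. [folklore] -/
theorem card_signs_erase {z : ℂ} (hz : z ∈ signs) : (signs.erase z).card = 2 := by
  rw [Finset.card_erase_of_mem hz, card_signs]

/-- The separating polynomial of a sign vector `c`: `P_c = ∏_i ∏_{ε ∈ signs ∖ {c i}} (G i - ε)`.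
[cite: RonyaiBabaiGanapathy2001, Thm. 1.1 (proof)] -/
noncomputable def sepPoly (G : ι → MvPolynomial (Fin p) ℂ) (c : ι → ℂ) : MvPolynomial (Fin p) ℂ :=
  ∏ i, ∏ ε ∈ signs.erase (c i), (G i - C ε)

/-- Evaluating the separating polynomial at a point `y` with `G(y) = c'`:
`P_c(y) = ∏_i ∏_{ε ≠ c i} (c' i - ε)`. [cite: RonyaiBabaiGanapathy2001, Thm. 1.1 (proof)] -/
theorem eval_sepPoly (G : ι → MvPolynomial (Fin p) ℂ) (c c' : ι → ℂ) (y : Fin p → ℂ)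
    (hy : ∀ i, eval y (G i) = c' i) :
    eval y (sepPoly G c) = ∏ i, ∏ ε ∈ signs.erase (c i), (c' i - ε) := by
  simp only [sepPoly, map_prod, map_sub, eval_C, hy]

/-- Diagonal: `P_c(y_c) ≠ 0`. [cite: RonyaiBabaiGanapathy2001, Thm. 1.1 (proof)] -/
theorem eval_sepPoly_self_ne_zero (G : ι → MvPolynomial (Fin p) ℂ) (c : ι → ℂ) (y : Fin p → ℂ)
    (hy : ∀ i, eval y (G i) = c i) : eval y (sepPoly G c) ≠ 0 := by
  rw [eval_sepPoly G c c y hy]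
  refine Finset.prod_ne_zero_iff.mpr fun i _ => Finset.prod_ne_zero_iff.mpr fun ε hε => ?_
  exact sub_ne_zero.mpr (Finset.ne_of_mem_erase hε).symm

/-- Off-diagonal: `P_c(y_{c'}) = 0` for a sign vector `c' ≠ c`.
[cite: RonyaiBabaiGanapathy2001, Thm. 1.1 (proof)] -/
theorem eval_sepPoly_eq_zero (G : ι → MvPolynomial (Fin p) ℂ) {c c' : ι → ℂ} (y : Fin p → ℂ)
    (hy : ∀ i, eval y (G i) = c' i) (hc' : ∀ i, c' i ∈ signs) (hne : c' ≠ c) :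
    eval y (sepPoly G c) = 0 := by
  rw [eval_sepPoly G c c' y hy]
  obtain ⟨i, hi⟩ : ∃ i, c' i ≠ c i := by
    by_contra h
    push Not at h
    exact hne (funext h)
  refine Finset.prod_eq_zero (Finset.mem_univ i) ?_
  exact Finset.prod_eq_zero (Finset.mem_erase.mpr ⟨hi, hc' i⟩) (sub_self _)

/-- Degree of the separating polynomial: `≤ #ι · (2δ)`. [cite: RonyaiBabaiGanapathy2001, Thm. 1.1 (proof)] -/
theorem totalDegree_sepPoly_le (G : ι → MvPolynomial (Fin p) ℂ) {δ : ℕ}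
    (hG : ∀ i, (G i).totalDegree ≤ δ) (c : ι → ℂ) (hc : ∀ i, c i ∈ signs) :
    (sepPoly G c).totalDegree ≤ Fintype.card ι * (2 * δ) := by
  unfold sepPoly
  have inner : ∀ i ∈ (Finset.univ : Finset ι),
      (∏ ε ∈ signs.erase (c i), (G i - C ε)).totalDegree ≤ 2 * δ := by
    intro i _
    refine (totalDegree_finsetProd _ _).trans ?_
    have hterm : ∀ ε ∈ signs.erase (c i), (G i - C ε).totalDegree ≤ δ :=
      fun ε _ => (totalDegree_sub_C_le _ _).trans (hG i)
    refine (Finset.sum_le_card_nsmul _ _ δ hterm).trans ?_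
    rw [card_signs_erase (hc i), smul_eq_mul]
  refine (totalDegree_finsetProd _ _).trans ?_
  refine (Finset.sum_le_card_nsmul _ _ (2 * δ) inner).trans ?_
  rw [Finset.card_univ, smul_eq_mul]

/-- Dimension bound: the polynomials of total degree `≤ d` in `p` variables have dimension
`≤ (d + 1) ^ p` (their exponent vectors inject into `Fin p → Fin (d+1)`). [folklore] -/
theorem finrank_restrictTotalDegree_le (p d : ℕ) :
    Module.finrank ℂ (restrictTotalDegree (Fin p) ℂ d) ≤ (d + 1) ^ p := by
  classical
  let sW : Set (Fin p →₀ ℕ) := {m | (m.sum fun _ e => e) ≤ d}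
  have hWdef : restrictTotalDegree (Fin p) ℂ d = restrictSupport ℂ sW := rfl
  let bW : Module.Basis sW ℂ (restrictTotalDegree (Fin p) ℂ d) :=
    hWdef ▸ basisRestrictSupport ℂ sW
  haveI : Finite sW := Finite.of_injective _ (LowDegreeEquations.degLE_injective (Fin p) d)
  rw [Module.finrank_eq_nat_card_basis bW]
  have := Nat.card_le_card_of_injective _ (LowDegreeEquations.degLE_injective (Fin p) d)
  rw [Nat.card_fun] at this
  simpa [Nat.card_eq_fintype_card] using this

/-- The space of polynomials of total degree `≤ d` in finitely many variables is finite-dimensional.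
[folklore] -/
theorem finite_restrictTotalDegree (p d : ℕ) :
    Module.Finite ℂ (restrictTotalDegree (Fin p) ℂ d) := by
  classical
  let sW : Set (Fin p →₀ ℕ) := {m | (m.sum fun _ e => e) ≤ d}
  have hWdef : restrictTotalDegree (Fin p) ℂ d = restrictSupport ℂ sW := rfl
  let bW : Module.Basis sW ℂ (restrictTotalDegree (Fin p) ℂ d) :=
    hWdef ▸ basisRestrictSupport ℂ sW
  haveI : Finite sW := Finite.of_injective _ (LowDegreeEquations.degLE_injective (Fin p) d)
  exact Module.Finite.of_basis bW

/-- **Zero-pattern count (diagonal case).** A finite set of sign vectors on the image of a polynomial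
map `ℂ^p → ℂ^ι` with coordinates of total degree `≤ δ` has at most `(2 · #ι · δ + 1) ^ p` elements.
[cite: RonyaiBabaiGanapathy2001, Thm. 1.1] -/
theorem card_le_of_signVectors_mem_image (G : ι → MvPolynomial (Fin p) ℂ) {δ : ℕ}
    (hG : ∀ i, (G i).totalDegree ≤ δ) (S : Finset (ι → ℂ))
    (hsign : ∀ c ∈ S, ∀ i, c i = 0 ∨ c i = 1 ∨ c i = -1)
    (himg : ∀ c ∈ S, ∃ y : Fin p → ℂ, ∀ i, eval y (G i) = c i) :
    S.card ≤ (2 * Fintype.card ι * δ + 1) ^ p := by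
  classical
  have hsign' : ∀ c ∈ S, ∀ i, c i ∈ signs := fun c hc i => (mem_signs_iff _).mpr (hsign c hc i)
  -- points on the image
  choose y hy using fun c : S => himg c.1 c.2
  -- the ambient finite-dimensional space
  set d := Fintype.card ι * (2 * δ) with hd
  let W : Submodule ℂ (MvPolynomial (Fin p) ℂ) := restrictTotalDegree (Fin p) ℂ d
  haveI : Module.Finite ℂ W := finite_restrictTotalDegree p d
  have hmem : ∀ c : S, sepPoly G c.1 ∈ W := fun c =>
    (mem_restrictTotalDegree _ _ _).mpr (totalDegree_sepPoly_le G hG c.1 (hsign' c.1 c.2))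
  let P : S → W := fun c => ⟨sepPoly G c.1, hmem c⟩
  -- linear independence by diagonal evaluation
  have hli : LinearIndependent ℂ P := by
    rw [Fintype.linearIndependent_iff]
    intro g hg c₀
    have h0 : (∑ c, g c • P c : W).1 = 0 := by rw [hg]; rfl
    have h1 : (∑ c, g c • P c : W).1 = ∑ c, g c • sepPoly G c.1 := by
      simp [P]
    rw [h1] at h0
    have h2 := congrArg (eval (y c₀)) h0
    rw [map_sum, map_zero] at h2
    rw [Finset.sum_eq_single c₀] at h2
    · rw [smul_eval, mul_eq_zero] at h2
      exact h2.resolve_right (eval_sepPoly_self_ne_zero G c₀.1 (y c₀) (hy c₀))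
    · intro c _ hc
      rw [smul_eval, eval_sepPoly_eq_zero G (y c₀) (hy c₀) (hsign' c₀.1 c₀.2)
        (fun h => hc (Subtype.ext h).symm), mul_zero]
    · intro h; exact absurd (Finset.mem_univ c₀) h
  have := hli.fintype_card_le_finrank
  rw [Fintype.card_coe] at this
  refine this.trans ((finrank_restrictTotalDegree_le p d).trans ?_)
  rw [hd]
  apply Nat.pow_le_pow_left
  have : Fintype.card ι * (2 * δ) = 2 * Fintype.card ι * δ := by ring
  omega

end ZeroPatterns

end Summit.ValiantsHypothesis.ValiantsHypothesis.Theorems.BarrierLever.NaturalProofsSeparateVNP
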